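import Summits.SmoothPoincare4.SmoothPoincare4.Theorems.ConvexBisectionAcyclicBisectionExistsPicardLefschetzPieces
import Literature.Topology.FourManifolds.LefschetzBaseShadow
import Literature.GroupTheory.CombinatorialGroupTheory.SignedHurwitzStabilisation
import HarnessLib

/-!
# The homological half of node N3b: a map acting as `embed` on a chain basis acts as `embed` on all shadows
(wave 6, brick G7-4 for node N3b `node_STembed` of stub `stub_STgeo` = N3 of NF4
`stub_modelsOnFibred_of_reach`, line `modp-braid-orbits`, crux `ConvexBisection.AcyclicBisectionExists`,
item stmt-SmoothPoincare4-10508; registered sub-goal `helper_shadow_comp_eq_embed`)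

Node N3b asks for a page embedding `ι : Base g → Base (g+1)` with
`shadow (g+1) (ι ∘ K) = embed g (shadow g K)` for all page loops `K`.  Whatever map `ι` the cap
cobordism of N3d finally produces (report G7 §0: `ι` must be the boundary trace of the
4-dimensional identification, not a free-standing map), the SHADOW clause reduces to `2g` loops:

* `shadow_comp_eq_of_chainBasis` — for a continuous `ι : Base g → Base g'`, a `ℤ`-linear
  `E : ℤ^{2g} → ℤ^{2g'}` and loops `L i` (`i < 2g`) of `Base g` with shadows the chain basis
  `chainVec g i`, if `shadow g' (ι ∘ L i) = E (chainVec g i)` for all `i` then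
  `shadow g' (ι ∘ K) = E (shadow g K)` for EVERY loop `K` of `Base g`;
* `shadow_comp_eq_embed` / `helper_shadow_comp_eq_embed` — the case `g' = g + 1`, `E = embed g`.

Proof: `K ↦ shadow g' (ι ∘ K)` is the linear map `shadowMap g' ∘ ι_*` on `H₁(Base g; ℤ)` read
through the Hurewicz class (`map_loopClass`, naturality), the chain shadow
`shadowMap g : H₁(Base g; ℤ) → ℤ^{2g}` is a linear bijection (`exists_isChainShadow_of`, Milnor's
Thm. 9.1 for the base) and `chainVec g` is a basis of `ℤ^{2g}` (`chainVec_basis`), so two linear maps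
agreeing on the classes `[L i]` agree.  Suitable families `L` exist on every page
(`exists_charted_chain`, Y4-5; `exists_pageLoop_shadow_eq`, Z6-2).  Everything is proved; no
definitions, no named facts, no `sorry`.  References: J. Milnor, *Singular points of complex
hypersurfaces* (1968), Thm. 9.1 [Milnor1968]; A. Hatcher, *Algebraic Topology* (2002), Thm. 2A.1
[HatcherAT2002].
-/

noncomputable section

set_option linter.dupNamespace false

open scoped Manifold ContDiff Topology
open Set Function Metric
open Literature.Topology.FourManifolds Literature.Topology.FourManifolds.LefschetzBase
  Literature.AlgebraicTopology.SingularHomology Literature.GroupTheory.CombinatorialGroupTheory.SignedHurwitz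

namespace Summit.SmoothPoincare4.SmoothPoincare4.Theorems.AcyclicBisectionExists.ModpBraidOrbits

open SingularSimplex

/-! ## §1 Naturality of the Hurewicz class of a circle map -/

/-- **The unit-period loop of `f ∘ K` has Hurewicz class `f_*` of that of `K`** (naturality,
Hatcher Thm. 2A.1). [cite: HatcherAT2002, Thm. 2A.1] -/
theorem loopClass_loopPath_comp {X Y : Type} [TopologicalSpace X] [TopologicalSpace Y]
    (f : C(X, Y)) {K : sphere (0 : EuclideanSpace ℝ (Fin 2)) 1 → X} (hK : Continuous K) :
    loopClass ℤ ℤ (1 : ℤ) (loopPath (f ∘ K) (f.continuous.comp hK)) =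
      singularHomology.map ℤ ℤ f 1 (loopClass ℤ ℤ (1 : ℤ) (loopPath K hK)) := by
  rw [map_loopClass]
  exact loopClass_eq_of_ofPath_eq _ _ _ _ _ (ofPath_congr _ _ fun _ => rfl)

/-! ## §2 A map acting linearly on a chain basis acts linearly on all shadows -/

variable {g g' : ℕ}

/-- **Shadows through a continuous map are governed by a chain basis.**  If `ι : Base g → Base g'`
is continuous, `E : ℤ^{2g} → ℤ^{2g'}` is `ℤ`-linear, and loops `L i` of `Base g` with
`shadow (L i) = chainVec g i` (`i < 2g`) satisfy `shadow (ι ∘ L i) = E (chainVec g i)`, then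
`shadow (ι ∘ K) = E (shadow K)` for every loop `K` of `Base g`. [cite: Milnor1968, Thm. 9.1] -/
theorem shadow_comp_eq_of_chainBasis {ι : Base g → Base g'} (hι : Continuous ι)
    (E : (Fin g ⊕ Fin g → ℤ) →ₗ[ℤ] (Fin g' ⊕ Fin g' → ℤ))
    (L : Fin (2 * g) → sphere (0 : EuclideanSpace ℝ (Fin 2)) 1 → Base g) (hL : ∀ i, Continuous (L i))
    (hLs : ∀ i, shadow g (L i) (hL i) = chainVec g i)
    (hιL : ∀ i, shadow g' (ι ∘ L i) (hι.comp (hL i)) = E (chainVec g i))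
    {K : sphere (0 : EuclideanSpace ℝ (Fin 2)) 1 → Base g} (hK : Continuous K) :
    shadow g' (ι ∘ K) (hι.comp hK) = E (shadow g K hK) := by
  classical
  set ιC : C(Base g, Base g') := ⟨ι, hι⟩ with hιC
  -- `F = shadowMap g' ∘ ι_*` on `H₁(Base g; ℤ)`
  set F : singularHomology ℤ ℤ (Base g) 1 →ₗ[ℤ] (Fin g' ⊕ Fin g' → ℤ) :=
    shadowMap g' ∘ₗ (singularHomology.map ℤ ℤ ιC 1).hom with hF
  have hFapply : ∀ x, F x = shadowMap g' (singularHomology.map ℤ ℤ ιC 1 x) := fun x => rfl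
  have hFloop : ∀ {M : sphere (0 : EuclideanSpace ℝ (Fin 2)) 1 → Base g} (hM : Continuous M),
      F (loopClass ℤ ℤ (1 : ℤ) (loopPath M hM)) = shadow g' (ι ∘ M) (hι.comp hM) := fun hM => by
    rw [hFapply, ← loopClass_loopPath_comp ιC hM]
    rfl
  -- the chain shadow of genus `g` as a linear bijection `σ`, with `σ⁻¹ (chainVec g i) = [L i]`
  have hσ := isChainShadow_shadowMap g (exists_isChainShadow_of g)
  set σ := LinearEquiv.ofBijective (shadowMap g) hσ.1 with hσdef
  have hσapply : ∀ x, σ x = shadowMap g x := fun x => rfl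
  have hx : ∀ i : Fin (2 * g), σ.symm (chainVec g i) = loopClass ℤ ℤ (1 : ℤ) (loopPath (L i) (hL i)) :=
      fun i => by
    rw [LinearEquiv.symm_apply_eq, hσapply]
    exact (hLs i).symm
  -- `F ∘ σ⁻¹ = E`: two linear maps agreeing on the basis `chainVec g`
  obtain ⟨bV, hbV⟩ := chainVec_basis g
  have hFE : F ∘ₗ σ.symm.toLinearMap = E := by
    refine bV.ext fun i => ?_
    rw [LinearMap.comp_apply, hbV, LinearEquiv.coe_toLinearMap, hx i, hFloop (hL i)]
    exact hιL i
  -- evaluate at `[K]`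
  rw [← hFloop hK, ← σ.symm_apply_apply (loopClass ℤ ℤ (1 : ℤ) (loopPath K hK)),
    ← LinearEquiv.coe_toLinearMap σ.symm, ← LinearMap.comp_apply, hFE, hσapply]
  rfl

/-- **The homological half of node N3b**: a continuous `ι : Base g → Base (g+1)` carrying loops
`L i` with shadows `chainVec g i` (`i < 2g`) to loops with shadows `embed g (chainVec g i)` satisfies
`shadow (g+1) (ι ∘ K) = embed g (shadow g K)` for every loop `K` of `Base g`. [cite: Milnor1968, Thm. 9.1] -/
theorem shadow_comp_eq_embed {ι : Base g → Base (g + 1)} (hι : Continuous ι)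
    (L : Fin (2 * g) → sphere (0 : EuclideanSpace ℝ (Fin 2)) 1 → Base g) (hL : ∀ i, Continuous (L i))
    (hLs : ∀ i, shadow g (L i) (hL i) = chainVec g i)
    (hιL : ∀ i, shadow (g + 1) (ι ∘ L i) (hι.comp (hL i)) = embed g (chainVec g i))
    {K : sphere (0 : EuclideanSpace ℝ (Fin 2)) 1 → Base g} (hK : Continuous K) :
    shadow (g + 1) (ι ∘ K) (hι.comp hK) = embed g (shadow g K hK) := by
  rw [← embedₗ_apply]
  exact shadow_comp_eq_of_chainBasis hι (embedₗ g) L hL hLs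
    (fun i => by rw [embedₗ_apply]; exact hιL i) hK

/-! ## §3 The registered form -/

/-- **Sub-goal `helper_shadow_comp_eq_embed`** (G7-4, the homological half of node N3b of NF4): a
continuous map `Base g → Base (g+1)` acting as `embed g` on the shadows of a family of loops
realising the chain basis acts as `embed g` on the shadows of all loops, in registered form.
[cite: Milnor1968, Thm. 9.1] -/
theorem helper_shadow_comp_eq_embed : ∀ (g : ℕ) (ι : Literature.Topology.FourManifolds.LefschetzBase.Base g → Literature.Topology.FourManifolds.LefschetzBase.Base (g + 1)) (hι : Continuous ι) (L : Fin (2 * g) → Metric.sphere (0 : EuclideanSpace ℝ (Fin 2)) 1 → Literature.Topology.FourManifolds.LefschetzBase.Base g) (hL : ∀ i, Continuous (L i)), (∀ i, Literature.Topology.FourManifolds.LefschetzBase.shadow g (L i) (hL i) = Literature.Topology.FourManifolds.LefschetzBase.chainVec g i) → (∀ i, Literature.Topology.FourManifolds.LefschetzBase.shadow (g + 1) (ι ∘ L i) (hι.comp (hL i)) = Literature.GroupTheory.CombinatorialGroupTheory.SignedHurwitz.embed g (Literature.Topology.FourManifolds.LefschetzBase.chainVec g i)) → ∀ (K : Metric.sphere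 (0 : EuclideanSpace ℝ (Fin 2)) 1 → Literature.Topology.FourManifolds.LefschetzBase.Base g) (hK : Continuous K), Literature.Topology.FourManifolds.LefschetzBase.shadow (g + 1) (ι ∘ K) (hι.comp hK) = Literature.GroupTheory.CombinatorialGroupTheory.SignedHurwitz.embed g (Literature.Topology.FourManifolds.LefschetzBase.shadow g K hK) :=
  fun _ _ hι L hL hLs hιL _ hK => shadow_comp_eq_embed hι L hL hLs hιL hK

end Summit.SmoothPoincare4.SmoothPoincare4.Theorems.AcyclicBisectionExists.ModpBraidOrbits

end
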